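import Mathlib
import Summits.Ventures.PercRepro2.LocRows
import Summits.Ventures.PercRepro2.LocUDom2
import Summits.Ventures.PercRepro2.LocMono

/-!
# Row (SW): the switch form of the free-fibre domination row 2′DOM
(blind cell PercRepro2, night-4 g3, 2026-08-24T09:3xZ; proofs/NIGHT4-SW.md)

On the free fibre let `Q = tgtU ends l h {S ∣ o ∈ S} = {h ∉ H_l, o ∈ R_side(l)}`.  Row 2′DOM on the
free fibre says that on `Q` the law of the blue cluster of `h` stochastically dominates the law of
its red cluster: for every up-set `𝓥`, `#{ζ ∈ Q : C_R(h) ∈ 𝓥} ≤ #{ζ ∈ Q : C_B(h) ∈ 𝓥}` (the first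
count is `#(srcU ∩ {C_B(h) ∈ 𝓥})` through the colour swap).  By Hall's theorem this is EQUIVALENT to
the existence of a permutation `Φ` of `Q` with `C_R(h)(ζ) ⊆ C_B(h)(Φ ζ)`:

* `Sw` — that permutation (an injection `Q → Q`, `C_R(h)` of the source inside `C_B(h)` of the image);
* `sw_of_locU` — the BL-local injection of row 2′LOC gives it (`Φ = ψ ∘ blue`), so `Sw` is the
  WEAKEST injection statement on the ladder `LocMono ⟹ LocU ⟹ Sw ⟹ 2′DOM ⟹ (BASE)`;
* `card_srcUIn_le_of_sw`, `dom2Sum_nonneg_of_sw`, `domSumG_univ_nonneg_of_sw` — `Sw` gives row 2′DOM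
  on the free fibre for every up-set `𝓥` (the `LocUDom2` chain with the weaker hypothesis);
* `sw_of_card_le` / `sw_iff_card_le` — the converse by Hall's marriage theorem
  (`Finset.all_card_le_biUnion_card_iff_exists_injective`): `Sw` holds iff the counting inequality
  holds for every up-set `𝓥`.  Hence the exact content of the weight-free base row 2′DOM on a
  graph is `Sw` — no locality, no monotonicity, no nesting clause is part of the statement.
-/

namespace Summit.Ventures.PercRepro2

namespace LocRows

open Hull

variable {V : Type*} {E : Type*} [Fintype E] [DecidableEq E]

open scoped Classical

variable (ends : E → Sym2 V)

/-- The colour swap exchanges the source and target sides of `(LOC-𝓤)`. -/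
lemma blue_mem_tgtU_iff {l h : V} {𝓤 : Set (Set V)} {ζ : Config E} :
    blue ζ ∈ tgtU ends l h 𝓤 ↔ ζ ∈ srcU ends l h 𝓤 := by
  simp [tgtU, srcU, hull_blue, blue_blue]

/-- The colour swap exchanges the target and source sides of `(LOC-𝓤)`. -/
lemma blue_mem_srcU_iff {l h : V} {𝓤 : Set (Set V)} {ζ : Config E} :
    blue ζ ∈ srcU ends l h 𝓤 ↔ ζ ∈ tgtU ends l h 𝓤 := by
  simp [tgtU, srcU, hull_blue, blue_blue]

/-- **Row (SW)**: an injection of `Q = {h ∉ H_l, o ∈ R_side(l)}` into itself carrying the red cluster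
of `h` into the blue cluster of `h` of the image. -/
def Sw (l h o : V) : Prop :=
  ∃ f : {ζ // ζ ∈ tgtU ends l h {S : Set V | o ∈ S}} → Config E, Function.Injective f ∧
    ∀ x, f x ∈ tgtU ends l h {S : Set V | o ∈ S} ∧
      cluster ends x.1 h ⊆ cluster ends (blue (f x)) h

/-- **(LOC-𝓤) at the principal up-set gives (SW)**: `Φ = ψ ∘ blue`. -/
theorem sw_of_locU (l h o : V) (hl : LocU ends l h {S : Set V | o ∈ S}) : Sw ends l h o := by
  obtain ⟨f, hf, hmem⟩ := hl
  refine ⟨fun x => f ⟨blue x.1, (blue_mem_srcU_iff ends).2 x.2⟩, ?_, ?_⟩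
  · intro x y hxy
    have h1 := hf hxy
    have h2 : blue x.1 = blue y.1 := congrArg Subtype.val h1
    have h3 : x.1 = y.1 := by
      have := congrArg blue h2
      simpa [blue_blue] using this
    exact Subtype.ext h3
  · intro x
    obtain ⟨ht, hloc⟩ := hmem ⟨blue x.1, (blue_mem_srcU_iff ends).2 x.2⟩
    refine ⟨ht, ?_⟩
    have hh : h ∉ hull ends (blue x.1) l := by
      rw [hull_blue]
      exact ((Finset.mem_filter.1 x.2).2).1
    have key := cluster_blue_subset_of_localAtSet_blue ends hh hloc
    simpa [blue_blue] using key

/-- **The counting inequality under (SW)**: `#(srcU ∩ {C_B(h) ∈ 𝓥}) ≤ #(tgtU ∩ {C_B(h) ∈ 𝓥})` at the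
principal up-set, for every up-set `𝓥` (the map `ζ ↦ Φ (blue ζ)`). -/
theorem card_srcUIn_le_of_sw {l h o : V} (hs : Sw ends l h o) {𝓥 : Set (Set V)}
    (h𝓥 : IsUpperSet 𝓥) :
    (((srcU ends l h {S : Set V | o ∈ S}).filter fun ζ => cluster ends (blue ζ) h ∈ 𝓥)).card ≤
      (((tgtU ends l h {S : Set V | o ∈ S}).filter fun ζ => cluster ends (blue ζ) h ∈ 𝓥)).card := by
  obtain ⟨f, hf, hmem⟩ := hs
  let F : Config E → Config E := fun ζ =>
    if hζ : blue ζ ∈ tgtU ends l h {S : Set V | o ∈ S} then f ⟨blue ζ, hζ⟩ else ζ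
  refine Finset.card_le_card_of_injOn F ?_ ?_
  · intro ζ hζ
    rw [Finset.mem_coe, Finset.mem_filter] at hζ
    have hb : blue ζ ∈ tgtU ends l h {S : Set V | o ∈ S} := (blue_mem_tgtU_iff ends).2 hζ.1
    have hF : F ζ = f ⟨blue ζ, hb⟩ := by simp [F, hb]
    rw [Finset.mem_coe, Finset.mem_filter, hF]
    obtain ⟨ht, hsub⟩ := hmem ⟨blue ζ, hb⟩
    refine ⟨ht, h𝓥 ?_ hζ.2⟩
    simpa using hsub
  · intro ζ₁ hζ₁ ζ₂ hζ₂ hF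
    rw [Finset.mem_coe, Finset.mem_filter] at hζ₁ hζ₂
    have hb1 : blue ζ₁ ∈ tgtU ends l h {S : Set V | o ∈ S} := (blue_mem_tgtU_iff ends).2 hζ₁.1
    have hb2 : blue ζ₂ ∈ tgtU ends l h {S : Set V | o ∈ S} := (blue_mem_tgtU_iff ends).2 hζ₂.1
    have hF1 : F ζ₁ = f ⟨blue ζ₁, hb1⟩ := by simp [F, hb1]
    have hF2 : F ζ₂ = f ⟨blue ζ₂, hb2⟩ := by simp [F, hb2]
    rw [hF1, hF2] at hF
    have h2 : blue ζ₁ = blue ζ₂ := congrArg Subtype.val (hf hF)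
    have := congrArg blue h2
    simpa [blue_blue] using this

variable {R : Type*} [Field R] [LinearOrder R] [IsStrictOrderedRing R]

/-- **(SW) gives row 2′DOM2 at the principal up-set on the free fibre, for every up-set `𝓥`.** -/
theorem dom2Sum_nonneg_of_sw {l h o : V} (hs : Sw ends l h o) {𝓥 : Set (Set V)}
    (h𝓥 : IsUpperSet 𝓥) : 0 ≤ dom2Sum ends R l h {S : Set V | o ∈ S} 𝓥 := by
  rw [dom2Sum_eq_card_sub_card, sub_nonneg]
  exact_mod_cast card_srcUIn_le_of_sw ends hs h𝓥

/-- **(SW) gives row 2′DOM on the free fibre** (every up-set `𝓥`, every pinning `z`). -/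
theorem domSumG_univ_nonneg_of_sw {l o h : V} (hs : Sw ends l h o) (z : Config E)
    {𝓥 : Set (Set V)} (h𝓥 : IsUpperSet 𝓥) : 0 ≤ domSumG R ends Finset.univ z l o h 𝓥 := by
  rw [← dom2Sum_principal_eq]
  exact dom2Sum_nonneg_of_sw ends hs h𝓥

/-! ## The converse: the counting inequality for every up-set gives (SW) (Hall) -/

/-- **Hall**: if `#(srcU ∩ {C_B(h) ∈ 𝓥}) ≤ #(tgtU ∩ {C_B(h) ∈ 𝓥})` for every up-set `𝓥`, then (SW). -/
theorem sw_of_card_le (l h o : V)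
    (hc : ∀ 𝓥 : Set (Set V), IsUpperSet 𝓥 →
      (((srcU ends l h {S : Set V | o ∈ S}).filter fun ζ => cluster ends (blue ζ) h ∈ 𝓥)).card ≤
        (((tgtU ends l h {S : Set V | o ∈ S}).filter fun ζ => cluster ends (blue ζ) h ∈ 𝓥)).card) :
    Sw ends l h o := by
  -- the neighbourhood of a source `x` under the (SW) relation
  let t : {ζ // ζ ∈ tgtU ends l h {S : Set V | o ∈ S}} → Finset (Config E) := fun x =>
    (tgtU ends l h {S : Set V | o ∈ S}).filter fun ζ' => cluster ends x.1 h ⊆ cluster ends (blue ζ') h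
  have hall : ∀ s : Finset {ζ // ζ ∈ tgtU ends l h {S : Set V | o ∈ S}},
      s.card ≤ (s.biUnion t).card := by
    intro s
    -- the up-set generated by the red clusters of `h` over `s`
    let 𝓥 : Set (Set V) := {S | ∃ x ∈ s, cluster ends x.1 h ⊆ S}
    have h𝓥 : IsUpperSet 𝓥 := by
      intro S S' hSS' ⟨x, hx, hxS⟩
      exact ⟨x, hx, hxS.trans hSS'⟩
    have e1 : s.biUnion t =
        (tgtU ends l h {S : Set V | o ∈ S}).filter fun ζ' => cluster ends (blue ζ') h ∈ 𝓥 := by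
      ext ζ'
      simp only [Finset.mem_biUnion, Finset.mem_filter, t, 𝓥, Set.mem_setOf_eq]
      constructor
      · rintro ⟨x, hx, hζ', hsub⟩
        exact ⟨hζ', x, hx, hsub⟩
      · rintro ⟨hζ', x, hx, hsub⟩
        exact ⟨x, hx, hζ', hsub⟩
    -- `s` injects into `srcU ∩ {C_B(h) ∈ 𝓥}` through the colour swap
    have e2 : s.card ≤
        (((srcU ends l h {S : Set V | o ∈ S}).filter fun ζ => cluster ends (blue ζ) h ∈ 𝓥)).card := by
      refine Finset.card_le_card_of_injOn (fun x => blue x.1) ?_ ?_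
      · intro x hx
        rw [Finset.mem_coe] at hx
        simp only [Finset.mem_coe, Finset.mem_filter]
        refine ⟨(blue_mem_srcU_iff ends).2 x.2, ?_⟩
        refine ⟨x, hx, ?_⟩
        simp [blue_blue]
      · intro x _ y _ hxy
        have h2 : blue x.1 = blue y.1 := hxy
        have h3 : x.1 = y.1 := by
          have := congrArg blue h2
          simpa [blue_blue] using this
        exact Subtype.ext h3
    rw [e1]
    refine e2.trans ?_
    convert hc 𝓥 h𝓥
    rfl
  obtain ⟨f, hf, hft⟩ := (Finset.all_card_le_biUnion_card_iff_exists_injective t).1 hall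
  refine ⟨f, hf, fun x => ?_⟩
  have := hft x
  simp only [t, Finset.mem_filter] at this
  exact this

/-- **(SW) is exactly the free-fibre domination row**: it holds iff the counting inequality of
row 2′DOM2 at the principal up-set holds for every up-set `𝓥`. -/
theorem sw_iff_card_le (l h o : V) :
    Sw ends l h o ↔ ∀ 𝓥 : Set (Set V), IsUpperSet 𝓥 →
      (((srcU ends l h {S : Set V | o ∈ S}).filter fun ζ => cluster ends (blue ζ) h ∈ 𝓥)).card ≤
        (((tgtU ends l h {S : Set V | o ∈ S}).filter fun ζ => cluster ends (blue ζ) h ∈ 𝓥)).card :=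
  ⟨fun hs _ h𝓥 => card_srcUIn_le_of_sw ends hs h𝓥, sw_of_card_le ends l h o⟩

/-- Row (SW) over all finite graphs and markings. -/
def Sw_all : Prop :=
  ∀ (V E : Type) [Fintype V] [DecidableEq V] [Fintype E] [DecidableEq E] (ends : E → Sym2 V)
    (l h o : V), l ≠ h → o ≠ l → o ≠ h → Sw ends l h o

/-- `LocMono_all` (row (LOC0-mono)) gives `Sw_all`. -/
theorem sw_all_of_locMono_all (hm : LocMono_all) : Sw_all := by
  intro V E _ _ _ _ ends l h o hlh hol hoh
  exact sw_of_locU ends l h o (locU_of_locMono ends l h o (hm V E ends l h o hlh hol hoh))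

end LocRows

end Summit.Ventures.PercRepro2
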